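import Mathlib
import HarnessLib
import Literature.Analysis.FluidPDE.BogovskiiBallSupBound
import Literature.Analysis.FluidPDE.NewtonKernel
import Literature.Analysis.FluidPDE.ClassicalLerayProjection
import Literature.Analysis.FluidPDE.CalderonSplittingLp
import Literature.Analysis.FluidPDE.PressurePoisson
import Literature.Analysis.FluidPDE.WholeSpaceIBP
import Literature.Analysis.FluidPDE.TaoEnergyLocalisationProofs

/-!
# Route `QuarterLogPincer`, crux `TypeIQuantSubcubicExp` (stmt-NavierStokesRegularity-24077), line `quiet_collar` — towards QP2
# (log-weighted typing `StubCutPairLog`), module D3: THE COMPACT-SUPPORT SURGERY OF A DIVERGENCE-FREE FIELD WITH A SMALL TAIL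

The Leray-projected cut datum `P = P[χa] = χa − ∇π[χa]` of QP2 is smooth and divergence-free but NOT compactly supported: off
`B(0,r+L)` it is the harmonic gradient `−∇π[χa]`, of size `≤ D ≍ ηq·(r+L)²/R₀²` beyond the radius `R₀ ≥ 2(r+L)`
(`…QuietCollarLerayData.exists_norm_gradient_divPotential_cutRef_far_le`).  `CutPairLog` wants a COMPACTLY SUPPORTED smooth
divergence-free datum.  This file performs the surgery, for ANY smooth divergence-free `P` with `‖P(x)‖ ≤ D` for `‖x‖ ≥ R₀`:

* cut with `λ = radialCutoff R₀ (2R₀)`: `λP` is smooth, supported in `B̄(0,2R₀)`, and `div(λP) = ∇λ·P` is smooth, supported in the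
  shell, of size `≤ (C₁/R₀)·D`, with total integral zero (divergence theorem);
* remove the divergence with the BOGOVSKIĬ CORRECTOR of `Literature.Analysis.FluidPDE.exists_smooth_divInverse_ball_norm_le` on the ball
  `B̄(0,2R₀)`: `W` smooth, `W = 0` off `B̄(0,2R₀)`, `div W = ∇λ·P`, and — the scale-invariant sup bound — `‖W‖ ≤ C·(2R₀)·(C₁D/R₀) =
  2CC₁·D`, UNIFORMLY IN `R₀`;
* `u₀ = λP − W`: `exists_divFree_compactSupport_surgery` — smooth, divergence-free, `u₀ = 0` off `B̄(0,2R₀)`, and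
  `‖u₀(x) − λ(x)P(x)‖ ≤ C·D` with the corrector `u₀ − λP = −W` supported in `B̄(0,2R₀)` (so its `L³` norm is
  `≤ C·D·|B̄(0,2R₀)|^{1/3}`, `eLpNorm_surgery_corrector_le`).

No exterior vector potential, no dipole expansion: the monopole decay of `∇π` and Bogovskiĭ's sup bound suffice.  r-INDEPENDENT
groundwork for QP2 (DIRECTOR-NS KEY-NS #187).  HONEST FRAME: an elementary construction; nothing here bears on 24077, W7 or
Navier–Stokes regularity (OPEN).  pub-ns-dss typer (g37), `--supports 24077`.
-/

noncomputable section

set_option linter.dupNamespace false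

namespace Summit.NavierStokesRegularity.NavierStokesRegularity.Cruxes.TypeIQuantSubcubicExp.QuietCollar

open MeasureTheory Set Function Filter Real Metric ContinuousLinearMap
open scoped ENNReal NNReal Topology
open Literature.Analysis Literature.Analysis.FluidPDE Literature.Analysis.FluidPDE.CalderonSplittingLp

/-- **COMPACT-SUPPORT SURGERY OF A DIVERGENCE-FREE FIELD WITH A SMALL TAIL**: there is an absolute `C > 0` such that for every
smooth divergence-free `P : ℝ³ → ℝ³`, every `R₀ > 0` and `D ≥ 0` with `‖P(x)‖ ≤ D` for `‖x‖ ≥ R₀`, there is a smooth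
divergence-free `u₀`, vanishing off `B̄(0,2R₀)`, with `‖u₀(x) − λ(x)P(x)‖ ≤ C·D` everywhere and `u₀ − λP` vanishing off
`B̄(0,2R₀)`, where `λ = radialCutoff R₀ (2R₀)` (`= 1` on `B̄(0,R₀)`, `= 0` off `B(0,2R₀)`): `u₀ = λP − W`, `W` the Bogovskiĭ
corrector of `div(λP) = ∇λ·P` on `B̄(0,2R₀)`. [folklore] -/
theorem exists_divFree_compactSupport_surgery :
    ∃ C : ℝ, 0 < C ∧ ∀ (P : EuclideanSpace ℝ (Fin 3) → EuclideanSpace ℝ (Fin 3)) (R₀ D : ℝ),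
      ContDiff ℝ (⊤ : ℕ∞) P → VectorCalculus.IsDivFree P → 0 < R₀ → 0 ≤ D → (∀ x, R₀ ≤ ‖x‖ → ‖P x‖ ≤ D) →
      ∃ u₀ : EuclideanSpace ℝ (Fin 3) → EuclideanSpace ℝ (Fin 3),
        ContDiff ℝ (⊤ : ℕ∞) u₀ ∧ VectorCalculus.IsDivFree u₀ ∧ HasCompactSupport u₀ ∧
        (∀ x, u₀ x ≠ 0 → ‖x‖ ≤ 2 * R₀) ∧
        (∀ x, ‖u₀ x - radialCutoff R₀ (2 * R₀) x • P x‖ ≤ C * D) ∧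
        (∀ x, u₀ x - radialCutoff R₀ (2 * R₀) x • P x ≠ 0 → ‖x‖ ≤ 2 * R₀) := by
  obtain ⟨CB, hCB, hBog⟩ := exists_smooth_divInverse_ball_norm_le
  obtain ⟨C₁, hC₁, hC₁b⟩ := exists_norm_fderiv_taoCutoff_le (E := EuclideanSpace ℝ (Fin 3))
  refine ⟨2 * CB * C₁, by positivity, ?_⟩
  intro P R₀ D hP hdiv hR₀ hD hfar
  have h2R₀ : R₀ < 2 * R₀ := by linarith
  set lam : EuclideanSpace ℝ (Fin 3) → ℝ := radialCutoff R₀ (2 * R₀) with hlam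
  -- the cut-off: smooth, compactly supported, gradient `≤ C₁/R₀`, constant off the shell
  have hlams : ContDiff ℝ (⊤ : ℕ∞) lam := radialCutoff_contDiff R₀ (2 * R₀)
  have hlamc : HasCompactSupport lam := hasCompactSupport_radialCutoff hR₀.le h2R₀
  have hlamd : ∀ x, ‖fderiv ℝ lam x‖ ≤ C₁ / R₀ := by
    have hw : 0 < ((2 * R₀) ^ 2 - R₀ ^ 2) / (2 * R₀) := div_pos (by nlinarith) (by linarith)
    have hfun : lam = taoCutoff (2 * R₀) (((2 * R₀) ^ 2 - R₀ ^ 2) / (2 * R₀)) :=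
      funext fun z => radialCutoff_eq_taoCutoff (by linarith) z
    intro x
    rw [hfun]
    refine (hC₁b (2 * R₀) _ hw (by linarith) x).trans (div_le_div_of_nonneg_left hC₁.le hR₀ ?_)
    rw [le_div_iff₀ (by linarith : (0 : ℝ) < 2 * R₀)]
    nlinarith
  have hlam_in : ∀ x : EuclideanSpace ℝ (Fin 3), ‖x‖ < R₀ → fderiv ℝ lam x = 0 := fun x hx => by
    rw [(radialCutoff_eventuallyEq_one hR₀.le h2R₀ hx).fderiv_eq, fderiv_const_apply]
  -- the cut field `λP`
  have hlamP : ContDiff ℝ (⊤ : ℕ∞) (fun y => lam y • P y) := hlams.smul hP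
  have hlamPc : HasCompactSupport (fun y => lam y • P y) := hlamc.smul_right
  have hlamP0 : ∀ x : EuclideanSpace ℝ (Fin 3), 2 * R₀ ≤ ‖x‖ → lam x • P x = 0 := fun x hx => by
    rw [hlam, radialCutoff_eq_zero hR₀.le h2R₀ hx, zero_smul]
  -- its divergence `h = ∇λ·P`
  set h : EuclideanSpace ℝ (Fin 3) → ℝ := VectorCalculus.divergence (fun y => lam y • P y) with hh
  have hh_eq : ∀ x, h x = fderiv ℝ lam x (P x) := by
    intro x
    rw [hh, divergence_smul_apply ((hlams.differentiable (by simp)) x) ((hP.differentiable (by simp)) x), hdiv x, mul_zero,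
      zero_add, real_inner_comm, gradient, InnerProductSpace.toDual_symm_apply]
  have hhs : ContDiff ℝ (⊤ : ℕ∞) h := contDiff_divergence_of_contDiff_top hlamP
  have hhc : HasCompactSupport h := CalderonSplittingLp.hasCompactSupport_divergence hlamPc
  have hh_supp : ∀ y, h y ≠ 0 → ‖y‖ ≤ 2 * R₀ := by
    intro y hy
    by_contra hcon
    have hlt : 2 * R₀ < ‖y‖ := not_le.1 hcon
    exact hy (by rw [hh_eq, (radialCutoff_eventuallyEq_zero hR₀.le h2R₀ hlt).fderiv_eq, fderiv_const_apply, zero_apply])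
  have hh0 : ∫ y, h y = 0 := integral_divergence_eq_zero (hlamP.of_le (by norm_cast)) hlamPc
  have hhD : ∀ y, |h y| ≤ C₁ / R₀ * D := by
    intro y
    rw [hh_eq]
    rcases lt_or_ge ‖y‖ R₀ with hy | hy
    · rw [hlam_in y hy, zero_apply, abs_zero]; positivity
    · rw [← Real.norm_eq_abs]
      exact (le_opNorm _ _).trans (mul_le_mul (hlamd y) (hfar y hy) (norm_nonneg _) (by positivity))
  -- the Bogovskiĭ corrector on `B̄(0,2R₀)`
  obtain ⟨W, hW, hWc, hW0, hWdiv, hWnorm⟩ := hBog (2 * R₀) h (C₁ / R₀ * D) (by linarith) hhs hhc hh_supp hh0 hhD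
  have hWle : ∀ x, ‖W x‖ ≤ 2 * CB * C₁ * D := fun x => by
    calc ‖W x‖ ≤ CB * (2 * R₀) * (C₁ / R₀ * D) := hWnorm x
      _ = 2 * CB * C₁ * D := by field_simp
  -- the datum `u₀ = λP − W`
  refine ⟨fun x => lam x • P x - W x, hlamP.sub hW, fun x => ?_, hlamPc.sub hWc, fun x hx => ?_, fun x => ?_, fun x hx => ?_⟩
  · rw [divergence_sub_apply ((hlamP.differentiable (by simp)) x) ((hW.differentiable (by simp)) x), hWdiv x, hh, sub_self]
  · by_contra hcon
    have hlt : 2 * R₀ < ‖x‖ := not_le.1 hcon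
    have hW0' : W x = 0 := by
      by_contra hne
      exact (not_le.2 hlt) (hW0 x hne)
    exact hx (show lam x • P x - W x = 0 by rw [hlamP0 x hlt.le, hW0', sub_zero])
  · show ‖lam x • P x - W x - radialCutoff R₀ (2 * R₀) x • P x‖ ≤ 2 * CB * C₁ * D
    rw [show lam x • P x - W x - radialCutoff R₀ (2 * R₀) x • P x = -W x by rw [hlam]; abel, norm_neg]
    exact hWle x
  · have hne : W x ≠ 0 := by
      intro h0
      apply hx
      show lam x • P x - W x - radialCutoff R₀ (2 * R₀) x • P x = 0
      rw [h0, sub_zero, hlam, sub_self]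
    exact hW0 x hne

/-- **`L³` SIZE OF THE SURGERY CORRECTOR**: a function vanishing off `B̄(0,ρ)` and bounded by `A` has
`‖f‖_{L³} ≤ A·|B̄(0,ρ)|^{1/3}` (comparison with `A·1_{B̄(0,ρ)}`). [folklore] -/
theorem eLpNorm_three_le_of_bound_of_support {f : EuclideanSpace ℝ (Fin 3) → EuclideanSpace ℝ (Fin 3)} {A ρ : ℝ}
    (hA : ∀ x, ‖f x‖ ≤ A) (hsupp : ∀ x, f x ≠ 0 → ‖x‖ ≤ ρ) :
    eLpNorm f 3 volume ≤ ENNReal.ofReal A * volume (Metric.closedBall (0 : EuclideanSpace ℝ (Fin 3)) ρ) ^ (1 / (3 : ℝ)) := by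
  have hA0 : 0 ≤ A := (norm_nonneg _).trans (hA 0)
  have hle : ∀ x, ‖f x‖ ≤ ‖(Metric.closedBall (0 : EuclideanSpace ℝ (Fin 3)) ρ).indicator (fun _ => A) x‖ := by
    intro x
    by_cases hx : x ∈ Metric.closedBall (0 : EuclideanSpace ℝ (Fin 3)) ρ
    · rw [Set.indicator_of_mem hx, Real.norm_of_nonneg hA0]; exact hA x
    · have : f x = 0 := by
        by_contra hne
        exact hx (by rw [Metric.mem_closedBall, dist_zero_right]; exact hsupp x hne)
      rw [this, norm_zero]; exact norm_nonneg _
  refine (eLpNorm_mono hle).trans ?_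
  rw [eLpNorm_indicator_const measurableSet_closedBall (by norm_num) (by norm_num), Real.enorm_eq_ofReal hA0]
  norm_num

end Summit.NavierStokesRegularity.NavierStokesRegularity.Cruxes.TypeIQuantSubcubicExp.QuietCollar

end
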